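import Mathlib
import HarnessLib
import Literature.NumberTheory.Transcendental.KZCalculus
import Literature.NumberTheory.Transcendental.KZLogCalculusProofs
import Literature.NumberTheory.Transcendental.KZHomotopyMoves
import Literature.NumberTheory.Transcendental.SemialgebraicLineDeriv

/-!
# Stub `stub_exactToFacesOne` of line `tame-bv-stokes` (crux `DihedralNormalForm`)

DIMENSION ONE of the descent of cubical representations: a convergent cubical representation
`[(0,1), q · x^a · (1 - x)^e]` (`a e : ℤ`, open unit interval written as the cube
`{x : ℝ¹ | ∀ i, x i ∈ (0,1)}`) lies in `KZ.relations ⊔ closure (CubRep 0)`, where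
`CubRep 0` are the constant representations `[pt, q₀]`, `q₀ ∈ ℚ`, over the one-point cube
`ℝ⁰`.

Proof.
* `q = 0`: the integrand vanishes on the domain, so the representation is a relation
  (`KZ.of_mem_relations_of_eqOn_zero`).
* `q ≠ 0`: absolute convergence on `(0,1)` forces `0 ≤ a` and `0 ≤ e`
  (`exactToFacesOne_nonneg_left/right`: transfer to `ℝ` along `MeasurableEquiv.funUnique`,
  multiply by the bounded continuous factor `q⁻¹ (1 - t)^{-e}` on `[0, 1/2]`
  (`IntegrableOn.continuousOn_mul_of_subset`) to get integrability of `t^a` on `(0, 1/2)`, which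
  by `intervalIntegral.integrableOn_Ioo_rpow_iff` means `-1 < a`; the exponent at `1` by the
  reflection `t ↦ 1 - t`, `IntervalIntegrable.comp_sub_left`). So the integrand is the rational
  POLYNOMIAL `P = q X^a (1 - X)^e` in `x 0`.
* ONE Newton–Leibniz move (rule 3 of the KZ calculus, `KZ.newtonLeibnizRel`) over the base
  `ℝ⁰` with bounds `a = 0`, `b = 1` and the rational polynomial primitive `F` of `P` (as in
  `Theorems/EllipticMomentKernel/Negative/PolyConst.lean`; `Polynomial.hasDerivAt_aeval`): the
  closed band `[0,1]` over the point carries `[band, P(x 0)]`, and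
  `[band, P] − [pt, F(1) − F(0)]` is the move;
  closed versus open interval is a null set (`KZ.of_sub_of_restrict_openBand_mem_relations`), and
  the given representation agrees with `[(0,1), P]` on its domain
  (`KZ.of_sub_of_mem_relations_of_eqOn`).
* `[pt, F(1) − F(0)]` is a cubical representation of dimension `0` (`F(1) − F(0) ∈ ℚ`, empty
  products), and `y = (y − [pt, F(1) − F(0)]) + [pt, F(1) − F(0)]` (`AddSubgroup.mem_sup`).
-/

noncomputable section

namespace Summit.KontsevichZagierPeriods.DihedralNormalForm.TameBVStokes

open MeasureTheory Set
open Literature.NumberTheory.Transcendental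
open Literature.ModelTheory.ExponentialFields (IsSemialgebraic isSemialgebraic_univ)

/-! ## One-variable analysis: convergence of `∫₀¹ t^a (1-t)^e dt` forces `a, e ≥ 0` -/

/-- If `q ≠ 0` and `t ↦ q · t^a · (1 - t)^e` (integer powers) is absolutely integrable on
`(0,1)`, then `0 ≤ a`: otherwise `t^a ≥ t⁻¹` near `0`. Multiplying by the factor
`q⁻¹ (1 - t)^{-e}`, continuous on `[0, 1/2]`, gives integrability of `t^a = t^{(a : ℝ)}` on
`(0, 1/2)`, i.e. `-1 < a` (`intervalIntegral.integrableOn_Ioo_rpow_iff`). [folklore] -/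
theorem exactToFacesOne_nonneg_left {q : ℝ} (hq : q ≠ 0) {a e : ℤ}
    (h : IntegrableOn (fun t : ℝ => q * (t ^ a * (1 - t) ^ e)) (Ioo (0:ℝ) 1)) : 0 ≤ a := by
  by_contra ha
  push Not at ha
  have hhalf : (0:ℝ) < 1 / 2 := by norm_num
  have h2 : IntegrableOn (fun t : ℝ => q * (t ^ a * (1 - t) ^ e)) (Ioo (0:ℝ) (1 / 2)) :=
    h.mono_set (Ioo_subset_Ioo_right (by norm_num))
  have hcont : ContinuousOn (fun t : ℝ => q⁻¹ * (1 - t) ^ (-e)) (Icc (0:ℝ) (1 / 2)) := by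
    have hc1 : Continuous (fun t : ℝ => (1:ℝ) - t) := by fun_prop
    refine continuousOn_const.mul (hc1.continuousOn.zpow₀ (-e) fun t ht => Or.inl ?_)
    show (1:ℝ) - t ≠ 0
    have := ht.2
    intro h0
    linarith
  have h3 : IntegrableOn (fun t : ℝ => (q⁻¹ * (1 - t) ^ (-e)) * (q * (t ^ a * (1 - t) ^ e)))
      (Ioo (0:ℝ) (1 / 2)) :=
    h2.continuousOn_mul_of_subset hcont isCompact_Icc measurableSet_Ioo Ioo_subset_Icc_self
  have h4 : IntegrableOn (fun t : ℝ => t ^ a) (Ioo (0:ℝ) (1 / 2)) := by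
    refine h3.congr_fun (fun t ht => ?_) measurableSet_Ioo
    have h1t : (1:ℝ) - t ≠ 0 := by have := ht.2; intro h0; linarith
    have h1t' : ((1:ℝ) - t) ^ e ≠ 0 := zpow_ne_zero e h1t
    simp only
    rw [zpow_neg]
    field_simp
  have h5 : IntegrableOn (fun t : ℝ => t ^ ((a : ℤ) : ℝ)) (Ioo (0:ℝ) (1 / 2)) :=
    h4.congr_fun (fun t _ => (Real.rpow_intCast t a).symm) measurableSet_Ioo
  have h6 := (intervalIntegral.integrableOn_Ioo_rpow_iff hhalf).1 h5
  have h7 : (-1 : ℤ) < a := by exact_mod_cast h6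
  omega

/-- If `q ≠ 0` and `t ↦ q · t^a · (1 - t)^e` (integer powers) is absolutely integrable on
`(0,1)`, then `0 ≤ e`: reflect `t ↦ 1 - t` (`IntervalIntegrable.comp_sub_left`) and apply
`exactToFacesOne_nonneg_left`. [folklore] -/
theorem exactToFacesOne_nonneg_right {q : ℝ} (hq : q ≠ 0) {a e : ℤ}
    (h : IntegrableOn (fun t : ℝ => q * (t ^ a * (1 - t) ^ e)) (Ioo (0:ℝ) 1)) : 0 ≤ e := by
  have h1 : IntervalIntegrable (fun t : ℝ => q * (t ^ a * (1 - t) ^ e)) volume 0 1 :=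
    (intervalIntegrable_iff_integrableOn_Ioo_of_le zero_le_one).2 h
  have h2 := (h1.comp_sub_left 1).symm
  rw [sub_self, sub_zero] at h2
  have h3 : IntegrableOn (fun t : ℝ => q * (t ^ e * (1 - t) ^ a)) (Ioo (0:ℝ) 1) := by
    have h4 := (intervalIntegrable_iff_integrableOn_Ioo_of_le zero_le_one).1 h2
    refine h4.congr_fun (fun t _ => ?_) measurableSet_Ioo
    simp only [sub_sub_cancel]
    ring
  exact exactToFacesOne_nonneg_left hq h3

/-- Transfer of absolute integrability from the open unit cube of `ℝ¹` to the open unit interval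
of `ℝ` along the measure-preserving `MeasurableEquiv.funUnique (Fin 1) ℝ`. [folklore] -/
theorem exactToFacesOne_integrableOn_real {g : ℝ → ℝ}
    (h : IntegrableOn (fun x : Fin 1 → ℝ => g (x 0))
      {x : Fin 1 → ℝ | ∀ i, x i ∈ Ioo (0:ℝ) 1}) :
    IntegrableOn g (Ioo (0:ℝ) 1) := by
  set e := MeasurableEquiv.funUnique (Fin 1) ℝ with he
  have hmp : MeasurePreserving e.symm volume volume :=
    (volume_preserving_funUnique (Fin 1) ℝ).symm e
  have h2 := (hmp.integrableOn_comp_preimage e.symm.measurableEmbedding).2 h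
  have hpre : e.symm ⁻¹' {x : Fin 1 → ℝ | ∀ i, x i ∈ Ioo (0:ℝ) 1} = Ioo (0:ℝ) 1 := by
    ext t
    simp [he]
  rw [hpre] at h2
  refine h2.congr_fun (fun t _ => ?_) measurableSet_Ioo
  simp [he]

/-! ## Rational polynomials on `ℝ¹` -/

/-- `F(1) − F(0)` for a rational polynomial `F`, computed in `ℚ` and cast to `ℝ`.
[folklore] -/
theorem exactToFacesOne_ratCast_eval (F : Polynomial ℚ) :
    (((Polynomial.eval 1 F - Polynomial.eval 0 F : ℚ)) : ℝ) =
      Polynomial.aeval (1:ℝ) F - Polynomial.aeval (0:ℝ) F := by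
  have h1 := Polynomial.aeval_algebraMap_apply_eq_algebraMap_eval (A := ℝ) (1:ℚ) F
  have h0 := Polynomial.aeval_algebraMap_apply_eq_algebraMap_eval (A := ℝ) (0:ℚ) F
  simp only [map_one, map_zero, eq_ratCast] at h1 h0
  rw [Rat.cast_sub, h1, h0]

/-! ## The Newton–Leibniz move over the point -/

/-- **A rational polynomial on the open unit interval is ONE Newton–Leibniz move away from a
rational constant over the point.** For `P ∈ ℚ[X]` and a representation `s` on the open unit
cube of `ℝ¹` whose integrand is `P(x 0)` on the domain, there is a representation `r` over the
cube `ℝ⁰` (one point) with constant rational integrand `F(1) − F(0)` (`F' = P`, `F` rational)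
such that `[s] − [r] ∈ KZ.relations`: congruence on the open interval, closed versus open band
(null endpoints), and rule (3) with primitive `F(x 0)` and bounds `0 ≤ 1` over `ℝ⁰`.
[cite: KontsevichZagier2001, §1.2 rule (3)] -/
theorem exactToFacesOne_poly (P : Polynomial ℚ) (s : KZ.IntegralRep 1)
    (hdom : s.domain = {x : Fin 1 → ℝ | ∀ i, x i ∈ Ioo (0:ℝ) 1})
    (hint : EqOn s.integrand (fun x => (Polynomial.aeval (x 0) P : ℝ)) s.domain) :
    ∃ (c : ℚ) (r : KZ.IntegralRep 0),
      r.domain = {x : Fin 0 → ℝ | ∀ i, x i ∈ Ioo (0:ℝ) 1} ∧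
      (r.integrand = fun _ => ((c : ℚ) : ℝ)) ∧ KZ.of s - KZ.of r ∈ KZ.relations := by
  -- a rational primitive `F` of `P` (cf. `exists_derivative_eq` of
  -- `Theorems/EllipticMomentKernel/Negative/PolyConst.lean`, inlined to keep this file route-local)
  have hprim : ∀ Q : Polynomial ℚ, ∃ F : Polynomial ℚ, Polynomial.derivative F = Q := by
    intro Q
    induction Q using Polynomial.induction_on' with
    | add p₁ p₂ hp₁ hp₂ =>
      obtain ⟨R₁, hR₁⟩ := hp₁
      obtain ⟨R₂, hR₂⟩ := hp₂
      exact ⟨R₁ + R₂, by rw [Polynomial.derivative_add, hR₁, hR₂]⟩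
    | monomial n b =>
      refine ⟨Polynomial.C (b / ((n : ℚ) + 1)) * Polynomial.X ^ (n + 1), ?_⟩
      have hn : ((n : ℚ) + 1) ≠ 0 := by positivity
      rw [Polynomial.derivative_C_mul_X_pow, ← Polynomial.C_mul_X_pow_eq_monomial,
        Nat.add_sub_cancel]
      congr 2
      push_cast
      exact div_mul_cancel₀ b hn
  obtain ⟨F, hF⟩ := hprim P
  -- rational polynomials in `x 0` are `ℚ`-semialgebraic functions on `ℝ¹`
  have hsaQ : ∀ {σ : Set (Fin 1 → ℝ)} (_ : IsSemialgebraic ℚ σ) (Q : Polynomial ℚ),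
      IsSemialgebraicFunOn ℚ σ (fun p => (Polynomial.aeval (p 0) Q : ℝ)) := by
    intro σ hσ Q
    refine (isSemialgebraicFunOn_aeval hσ
      (Polynomial.aeval (MvPolynomial.X 0 : MvPolynomial (Fin 1) ℚ) Q)).congr fun p _ => ?_
    show MvPolynomial.aeval p (Polynomial.aeval (MvPolynomial.X 0 : MvPolynomial (Fin 1) ℚ) Q) =
      Polynomial.aeval (p 0) Q
    rw [← Polynomial.aeval_algHom_apply, MvPolynomial.aeval_X]
  -- the base: the cube `ℝ⁰`, i.e. the point
  have hBuniv : {x : Fin 0 → ℝ | ∀ i, x i ∈ Ioo (0:ℝ) 1} = univ :=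
    eq_univ_of_forall fun x i => i.elim0
  have hBsa : IsSemialgebraic ℚ {x : Fin 0 → ℝ | ∀ i, x i ∈ Ioo (0:ℝ) 1} := by
    rw [hBuniv]; exact isSemialgebraic_univ
  have hvolB : volume {x : Fin 0 → ℝ | ∀ i, x i ∈ Ioo (0:ℝ) 1} = 1 := by
    rw [hBuniv, volume_pi, Measure.pi_univ]; simp
  have h0sa : IsSemialgebraicFunOn ℚ {x : Fin 0 → ℝ | ∀ i, x i ∈ Ioo (0:ℝ) 1}
      (fun _ => (0:ℝ)) := by
    simpa using isSemialgebraicFunOn_ratCast hBsa 0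
  have h1sa : IsSemialgebraicFunOn ℚ {x : Fin 0 → ℝ | ∀ i, x i ∈ Ioo (0:ℝ) 1}
      (fun _ => (1:ℝ)) := by
    simpa using isSemialgebraicFunOn_ratCast hBsa 1
  -- the closed band `[0,1]` over the point
  have hband_sa : IsSemialgebraic ℚ
      (KZlog.band {x : Fin 0 → ℝ | ∀ i, x i ∈ Ioo (0:ℝ) 1} (fun _ => 0) (fun _ => 1)) :=
    KZlog.isSemialgebraic_band h0sa h1sa
  have hband_sub :
      KZlog.band {x : Fin 0 → ℝ | ∀ i, x i ∈ Ioo (0:ℝ) 1} (fun _ => (0:ℝ)) (fun _ => 1)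
        ⊆ Icc (0 : Fin 1 → ℝ) 1 := by
    intro z hz
    rw [KZlog.mem_band] at hz
    rw [mem_Icc, Pi.le_def, Pi.le_def]
    exact ⟨fun i => by fin_cases i; exact hz.2.1, fun i => by fin_cases i; exact hz.2.2⟩
  have hcontP : Continuous fun p : Fin 1 → ℝ => (Polynomial.aeval (p 0) P : ℝ) :=
    (Polynomial.continuous_aeval P).comp (continuous_apply 0)
  let rb : KZ.IntegralRep 1 :=
    ⟨KZlog.band {x : Fin 0 → ℝ | ∀ i, x i ∈ Ioo (0:ℝ) 1} (fun _ => 0) (fun _ => 1),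
      fun p => (Polynomial.aeval (p 0) P : ℝ), hband_sa,
      hsaQ hband_sa P,
      (hcontP.continuousOn.integrableOn_compact isCompact_Icc).mono_set hband_sub⟩
  -- the constant over the point
  set c : ℚ := Polynomial.eval 1 F - Polynomial.eval 0 F with hc
  let rd : KZ.IntegralRep 0 :=
    ⟨{x : Fin 0 → ℝ | ∀ i, x i ∈ Ioo (0:ℝ) 1}, fun _ => ((c : ℚ) : ℝ), hBsa,
      isSemialgebraicFunOn_ratCast hBsa c,
      integrableOn_const (by rw [hvolB]; exact ENNReal.one_ne_top)⟩
  -- rule (3): `[band, P] − [pt, F 1 − F 0]`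
  have hNL : KZ.of rb - KZ.of rd ∈ KZ.newtonLeibnizRel := by
    refine ⟨0, rb, rd, fun _ => 0, fun _ => 1, fun z => (Polynomial.aeval (z 0) F : ℝ),
      hsaQ hband_sa F, h0sa, h1sa, fun _ _ => zero_le_one,
      rfl, ?_, ?_, ?_, rfl⟩
    · intro x _
      show ContinuousOn
        (fun t : ℝ => (Polynomial.aeval ((Fin.snoc x t : Fin 1 → ℝ) 0) F : ℝ)) _
      simp only [Fin.snoc_zero]
      exact (Polynomial.continuous_aeval F).continuousOn
    · intro x _ t _
      show HasDerivAt (fun s : ℝ => (Polynomial.aeval ((Fin.snoc x s : Fin 1 → ℝ) 0) F : ℝ))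
        (Polynomial.aeval ((Fin.snoc x t : Fin 1 → ℝ) 0) P) t
      simp only [Fin.snoc_zero]
      have := Polynomial.hasDerivAt_aeval (R := ℚ) F t
      rwa [hF] at this
    · intro x _
      show ((c : ℚ) : ℝ) =
          Polynomial.aeval ((Fin.snoc x ((fun _ => (1:ℝ)) x) : Fin 1 → ℝ) 0) F -
            Polynomial.aeval ((Fin.snoc x ((fun _ => (0:ℝ)) x) : Fin 1 → ℝ) 0) F
      simp only [Fin.snoc_zero]
      exact exactToFacesOne_ratCast_eval F
  -- closed versus open band
  obtain ⟨r'', hd'', hi'', hrel⟩ :=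
    KZ.of_sub_of_restrict_openBand_mem_relations h0sa h1sa rb rfl
  -- congruence with the given representation
  have hsd : s.domain = r''.domain := by
    rw [hdom, hd'']
    ext z
    simp only [mem_setOf_eq, Fin.forall_fin_one, Fin.last_zero, mem_Ioo, IsEmpty.forall_iff,
      true_and]
  have hcongr : KZ.of r'' - KZ.of s ∈ KZ.relations := by
    refine KZ.of_sub_of_mem_relations_of_eqOn hsd fun z hz => ?_
    rw [hi'']
    have hz' : z ∈ s.domain := by rwa [hsd]
    exact (hint hz').symm
  refine ⟨c, rd, rfl, rfl, ?_⟩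
  have : KZ.of s - KZ.of rd =
      (KZ.of rb - KZ.of rd) - (KZ.of rb - KZ.of r'') - (KZ.of r'' - KZ.of s) := by abel
  rw [this]
  exact KZ.relations.sub_mem (KZ.relations.sub_mem (KZ.newtonLeibnizRel_subset_relations hNL) hrel)
    hcongr

/-! ## The stub -/

/-- **`stub_exactToFacesOne`** (line `tame-bv-stokes`, crux `DihedralNormalForm`). DIMENSION ONE:
a convergent cubical representation `[(0,1), q · x^a · (1 - x)^e]` (`a e : ℤ`) lies in
`KZ.relations ⊔ closure (CubRep 0)`. If `q = 0` it is a relation (zero integrand); otherwise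
absolute convergence at the two endpoints forces `a ≥ 0` and `e ≥ 0`
(`exactToFacesOne_nonneg_left/right`), the integrand is the rational polynomial
`q X^a (1 - X)^e` in `x 0`, and ONE Newton–Leibniz move with its polynomial primitive `F`
(rule 3 over the one-point base, bounds `0 ≤ 1`; closed versus open interval is a null set)
lands on the constant `[pt, F(1) − F(0)]`, a cubical representation of dimension `0`
(`exactToFacesOne_poly`). [cite: KontsevichZagier2001, §1.2 rule (3)] -/
theorem stub_exactToFacesOne (CubRep : ℕ → Set Literature.NumberTheory.Transcendental.KZ.FormalRep) (hCubRep : ∀ k, CubRep k = {y : Literature.NumberTheory.Transcendental.KZ.FormalRep | ∃ (q : ℚ) (a : Fin k → ℤ) (e : Fin k → Fin k → ℤ) (s : Literature.NumberTheory.Transcendental.KZ.IntegralRep k), s.domain = {x : Fin k → ℝ | ∀ i, x i ∈ Set.Ioo (0:ℝ) 1} ∧ Set.EqOn s.integrand (fun x => (q : ℝ) * ((∏ i, x i ^ a i) * ∏ i, ∏ j, if i ≤ j then (1 - ∏ l, if i ≤ l ∧ l ≤ j then x l else 1) ^ e i j else 1)) s.domain ∧ y = Literature.NumberTheory.Transcendental.KZ.of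 s}) : ∀ y ∈ CubRep 1, y ∈ Literature.NumberTheory.Transcendental.KZ.relations ⊔ AddSubgroup.closure (CubRep 0) := by
  intro y hy
  rw [hCubRep] at hy
  obtain ⟨q, a, e, s, hdom, hint, rfl⟩ := hy
  -- the integrand in dimension one
  have hint1 :
      EqOn s.integrand (fun x => (q : ℝ) * (x 0 ^ a 0 * (1 - x 0) ^ e 0 0)) s.domain := by
    intro x hx
    rw [hint hx]
    simp
  by_cases hq : q = 0
  · -- zero integrand: a relation
    have h0 : EqOn s.integrand 0 s.domain := fun x hx => by
      rw [hint1 hx]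
      simp [hq]
    exact (le_sup_left : KZ.relations ≤ KZ.relations ⊔ AddSubgroup.closure (CubRep 0))
      (KZ.of_mem_relations_of_eqOn_zero s h0)
  -- `q ≠ 0`: absolute convergence forces nonnegative exponents
  have hq' : (q : ℝ) ≠ 0 := by exact_mod_cast hq
  have hI :
      IntegrableOn (fun t : ℝ => (q : ℝ) * (t ^ a 0 * (1 - t) ^ e 0 0)) (Ioo (0:ℝ) 1) := by
    refine exactToFacesOne_integrableOn_real
      (g := fun t => (q : ℝ) * (t ^ a 0 * (1 - t) ^ e 0 0)) ?_
    have hmeas : MeasurableSet s.domain := KZ.IntegralRep.measurableSet_domain_holds s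
    have h := s.integrableOn.congr_fun hint1 hmeas
    rwa [hdom] at h
  obtain ⟨a₀, ha₀⟩ := Int.eq_ofNat_of_zero_le (exactToFacesOne_nonneg_left hq' hI)
  obtain ⟨e₀, he₀⟩ := Int.eq_ofNat_of_zero_le (exactToFacesOne_nonneg_right hq' hI)
  -- so the integrand is a rational polynomial in `x 0`
  set P : Polynomial ℚ := Polynomial.C q * Polynomial.X ^ a₀ * (1 - Polynomial.X) ^ e₀ with hP
  have hPeval :
      ∀ t : ℝ, (Polynomial.aeval t P : ℝ) = (q : ℝ) * (t ^ a₀ * (1 - t) ^ e₀) := by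
    intro t
    simp [hP, mul_assoc]
  have hint2 : EqOn s.integrand (fun x => (Polynomial.aeval (x 0) P : ℝ)) s.domain := by
    intro x hx
    show s.integrand x = Polynomial.aeval (x 0) P
    rw [hint1 hx]
    simp only [hPeval, ha₀, he₀, zpow_natCast]
  -- one Newton–Leibniz move to a rational constant over the point
  obtain ⟨c, r, hrd, hri, hrel⟩ := exactToFacesOne_poly P s hdom hint2
  have hr : KZ.of r ∈ CubRep 0 := by
    rw [hCubRep]
    refine ⟨c, fun _ => 0, fun _ _ => 0, r, hrd, fun x _ => ?_, rfl⟩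
    simp [hri]
  refine AddSubgroup.mem_sup.2
    ⟨KZ.of s - KZ.of r, hrel, KZ.of r, AddSubgroup.subset_closure hr, ?_⟩
  abel

end Summit.KontsevichZagierPeriods.DihedralNormalForm.TameBVStokes
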